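import Summits.BirchSwinnertonDyer.BirchSwinnertonDyer.Theorems.ResidualThetaTransportAtTwoThetaLayerLambdaCongruenceAtTwoManinSystemFactor
import Summits.BirchSwinnertonDyer.BirchSwinnertonDyer.Theorems.ResidualThetaTransportAtTwoThetaLayerLambdaCongruenceAtTwoParabolicCharacterFactor
import Literature.NumberTheory.EllipticCurves.ModularCurveGenusIntegralityProofs
import HarnessLib

/-!
# Crux `ThetaLayerLambdaCongruenceAtTwo` (stmt-BirchSwinnertonDyer-20688, route ResidualThetaTransportAtTwo), line
# `birth` v13 — SD floor at `ℓ = 2`, brick S3 (part 2): the DUAL MODEL — `Hom(Λ, R)` IS «Manin systems killing the elliptic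
# cosets modulo boundary systems»: the kernel of `M ↦ φ_M` is the boundary systems, and `M ↦ φ_M` is onto (width seat
# bsd-wall-rtt-p3-w2 g8; `--supports stmt-BirchSwinnertonDyer-20688 --as helper`; closes nothing)

HONEST FRAMING. THEOREMS only, in the coset currency of `…ManinSymbolTorsion` / `…PeriodFactor` / `…ManinSystemFactor`. No definition;
nothing about any curve or form is asserted; BSD is not proved by any of this.

WHAT. `R` an additive group (without `3`-torsion where stated), `Λ = periodHomology N`, Manin chains as in `…ManinChain`.
* §1 `exists_boundary_of_chainSum_eq_zero` (kernel ⊆ boundary): if `M : Gamma0Coset N → R` satisfies `M(S·q) = −M(q)` and ALL closed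
  chain sums vanish (`Σ_{g∈L} M(g⁻¹Γ₀(N)) = 0` for every chain `L` of every `k ∈ Γ₀(N)`), then `M` is a BOUNDARY system:
  `M(g⁻¹Γ₀(N)) = ψ[g∞] − ψ[gS∞]` for a function `ψ` on the cusp classes (`cuspOrbitOf N`). Mechanism: the path sum `S(k) = Σ_{chain of k} M`
  is chain-independent (two chains of `k` differ by a closed chain of `1`), `Γ₀(N)`-invariant on the left, `±Tʲ`-invariant on the
  right, hence a function of `[k∞]` (`cuspOrbitOf_eq_iff`, `exists_eq_T_zpow_or_of_apply_one_zero`); and `M(g⁻¹Γ₀(N)) = S(g) − S(gS)`.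
  With `…ManinSystemFactor.boundarySystem_chainSum_eq_zero`: kernel of `M ↦ φ_M` = boundary systems.
* §2 `exists_maninSystem_of_addMonoidHom_periodHomology` (surjectivity): every additive `φ : Λ → R` (`R` without `3`-torsion) is a
  `φ_M`: `u = φ ∘ per` kills cusp stabilisers and order-`4` elliptics (`cuspCharacter_of_addMonoidHom_periodHomology`), so it is the
  period homomorphism of a symbol function `Φ_u` (`exists_maninFunction_of_cuspCharacter`), whose Manin system `M` on the coset space
  satisfies (i)–(iv) and has chain sums `Σ_{g∈L} M = Φ̂_u(k) = u(k) = φ({∞, k∞})` (`maninChain_sum_maninSymbol`).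
Together with `…ManinSystemFactor`: **`Hom(Λ, R) ≅ {Manin systems with (i)–(iv)} / {boundary systems}`** for every `R` without
`3`-torsion — Lefschetz duality `H¹(X₀(N); R) ≅ H₁(Y₀(N); R)/⟨cusp loops⟩` from coset data; with `R = 𝔽₂` this is the DUAL MODEL
`ker ∂₂ᵀ/im ∂₁ᵀ ≅ Hom(Λ, 𝔽₂)` of the sign-free architecture `Cruxes/…/Lines/birth-sd2-architecture.md` (brick S3).

References: [Manin1972] §1.5–1.7, Thm. 1.6, Thm. 1.9; [CremonaAlgorithms1997] §2.1–2.2; [DiamondShurman2005] §3.8 (cusps of Γ₀(N)).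
-/

set_option autoImplicit false

noncomputable section

-- justification: the `Summit.BirchSwinnertonDyer.BirchSwinnertonDyer.…` path repeats a component (route-file convention)
set_option linter.dupNamespace false

open scoped Classical MatrixGroups

open CongruenceSubgroup Matrix.SpecialLinearGroup ModularGroup
open Literature.NumberTheory.EllipticCurves.ModularForms

namespace Summit.BirchSwinnertonDyer.BirchSwinnertonDyer.Theorems.ThetaLayerLambdaCongruenceAtTwo

/-! ## §1. Kernel: a Manin system with vanishing closed chain sums is a boundary system -/

section Kernel

variable {R : Type} [AddCommGroup R] {N : ℕ} [NeZero N]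

/-- **Kernel ⊆ boundary systems.** Let `M : Gamma0Coset N → R` satisfy `M(S·q) = −M(q)` and have vanishing closed chain sums:
`Σ_{g∈L} M(g⁻¹Γ₀(N)) = 0` for every Manin chain `L` of every `k ∈ Γ₀(N)`. Then there is `ψ : CuspOrbits Γ₀(N) → R` with
`M(g⁻¹Γ₀(N)) = ψ[g∞] − ψ[gS∞]` for all `g ∈ SL₂(ℤ)` — `M` is the coboundary of a function on the cusps (a sum of cusp loops).
[cite: Manin1972, Thm. 1.6] [cite: DiamondShurman2005, §3.8] -/
theorem exists_boundary_of_chainSum_eq_zero (M : Gamma0Coset N → R) (hM1 : ∀ q, M (S • q) = -M q)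
    (h0 : ∀ (k : Gamma0 N) (L : List SL(2, ℤ)),
      (∀ {A : Type} [AddCommGroup A] (F : SL(2, ℤ) → A), (∀ g, F (g * T) = F g) → (∀ g, F (-g) = F g) →
        (L.map fun g ↦ F g - F (g * S)).sum = F (k : SL(2, ℤ)) - F 1) →
      (L.map fun g ↦ M ((g⁻¹ : SL(2, ℤ)) : Gamma0Coset N)).sum = 0) :
    ∃ ψ : CuspOrbits (Gamma0 N : Subgroup (GL (Fin 2) ℝ)) → R,
      ∀ g : SL(2, ℤ), M ((g⁻¹ : SL(2, ℤ)) : Gamma0Coset N) = ψ (cuspOrbitOf N g) - ψ (cuspOrbitOf N (g * S)) := by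
  -- notation
  let Mc : SL(2, ℤ) → R := fun g ↦ M ((g⁻¹ : SL(2, ℤ)) : Gamma0Coset N)
  have hMc : ∀ g, Mc g = M ((g⁻¹ : SL(2, ℤ)) : Gamma0Coset N) := fun g ↦ rfl
  have hMcS : ∀ g, Mc (g * S) = -Mc g := fun g ↦ by
    rw [hMc, hMc, mul_inv_rev, S_inv_eq_neg_S, neg_mul]
    rw [show ((-(S * g⁻¹) : SL(2, ℤ)) : Gamma0Coset N) = (-S) • ((g⁻¹ : SL(2, ℤ)) : Gamma0Coset N) by
      rw [MulAction.Quotient.smul_mk, smul_eq_mul, neg_mul], neg_smul_coset, hM1]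
  have hMcγ : ∀ (γ : Gamma0 N) (g : SL(2, ℤ)), Mc ((γ : SL(2, ℤ)) * g) = Mc g := fun γ g ↦ by
    rw [hMc, hMc, mul_inv_rev]
    congr 1
    rw [QuotientGroup.eq]
    simp
  -- chains for every `k ∈ SL₂(ℤ)`
  choose ch hch using fun k : SL(2, ℤ) ↦ exists_maninChain.{0} k
  let Sf : SL(2, ℤ) → R := fun k ↦ ((ch k).map Mc).sum
  -- (W) chain sums only depend on `k`
  have hW : ∀ (k : SL(2, ℤ)) (L : List SL(2, ℤ)),
      (∀ {A : Type} [AddCommGroup A] (F : SL(2, ℤ) → A), (∀ g, F (g * T) = F g) → (∀ g, F (-g) = F g) →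
        (L.map fun g ↦ F g - F (g * S)).sum = F k - F 1) →
      (L.map Mc).sum = Sf k := by
    intro k L hL
    -- `L ++ (ch k)·S` is a closed chain of `1`
    have hcl : ∀ {A : Type} [AddCommGroup A] (F : SL(2, ℤ) → A), (∀ g, F (g * T) = F g) → (∀ g, F (-g) = F g) →
        ((L ++ (ch k).map fun g ↦ g * S).map fun g ↦ F g - F (g * S)).sum = F ((1 : Gamma0 N) : SL(2, ℤ)) - F 1 := by
      intro A _ F hT hn
      rw [List.map_append, List.sum_append, hL F hT hn, List.map_map, OneMemClass.coe_one, sub_self]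
      have e : ((ch k).map ((fun g ↦ F g - F (g * S)) ∘ fun g ↦ g * S)).sum = -((ch k).map fun g ↦ F g - F (g * S)).sum := by
        rw [List.sum_neg, List.map_map]
        congr 1
        refine List.map_congr_left fun g _ ↦ ?_
        simp only [Function.comp_apply, mul_assoc, S_mul_S_eq_neg_one, mul_neg, mul_one, hn, neg_sub]
      rw [e, hch k F hT hn]
      abel
    have h := h0 1 _ hcl
    rw [List.map_append, List.sum_append, List.map_map] at h
    have e : ((ch k).map (Mc ∘ fun g ↦ g * S)).sum = -((ch k).map Mc).sum := by
      rw [List.sum_neg, List.map_map]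
      congr 1
      exact List.map_congr_left fun g _ ↦ hMcS g
    rw [e, ← sub_eq_add_neg, sub_eq_zero] at h
    exact h
  -- left `Γ₀(N)`-invariance
  have hγ : ∀ (γ : Gamma0 N) (k : SL(2, ℤ)), Sf ((γ : SL(2, ℤ)) * k) = Sf k := by
    intro γ k
    have hL : ∀ {A : Type} [AddCommGroup A] (F : SL(2, ℤ) → A), (∀ g, F (g * T) = F g) → (∀ g, F (-g) = F g) →
        ((ch (γ : SL(2, ℤ)) ++ (ch k).map fun g ↦ (γ : SL(2, ℤ)) * g).map fun g ↦ F g - F (g * S)).sum =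
          F ((γ : SL(2, ℤ)) * k) - F 1 := by
      intro A _ F hT hn
      rw [List.map_append, List.sum_append, hch (γ : SL(2, ℤ)) F hT hn, List.map_map]
      have h2 := hch k (fun g ↦ F ((γ : SL(2, ℤ)) * g)) (fun g ↦ by rw [← mul_assoc, hT])
        (fun g ↦ by simp only [mul_neg, hn])
      simp only [mul_one] at h2
      rw [show ((ch k).map ((fun g ↦ F g - F (g * S)) ∘ fun g ↦ (γ : SL(2, ℤ)) * g)).sum =
        ((ch k).map fun g ↦ F ((γ : SL(2, ℤ)) * g) - F ((γ : SL(2, ℤ)) * (g * S))).sum from by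
          congr 1; exact List.map_congr_left fun g _ ↦ by simp [mul_assoc], h2]
      abel
    rw [← hW _ _ hL, List.map_append, List.sum_append, List.map_map, h0 γ _ (hch (γ : SL(2, ℤ))), zero_add]
    congr 1
    exact List.map_congr_left fun g _ ↦ hMcγ γ g
  -- right `±Tʲ`-invariance
  have hTz : ∀ (k : SL(2, ℤ)) (j : ℤ), Sf (k * T ^ j) = Sf k := fun k j ↦ by
    refine (hW (k * T ^ j) (ch k) fun F hT hn ↦ ?_).symm
    rw [hch k F hT hn, apply_mul_T_zpow_of_apply_mul_T F hT]
  have hneg : ∀ k : SL(2, ℤ), Sf (-k) = Sf k := fun k ↦ by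
    refine (hW (-k) (ch k) fun F hT hn ↦ ?_).symm
    rw [hch k F hT hn, hn]
  -- `Sf` is a function of the cusp class
  have hcusp : ∀ g g' : SL(2, ℤ), cuspOrbitOf N g = cuspOrbitOf N g' → Sf g = Sf g' := by
    intro g g' h
    obtain ⟨γ, hγmem, hzero⟩ := (cuspOrbitOf_eq_iff N g g').mp h
    obtain ⟨j, hj⟩ := exists_eq_T_zpow_or_of_apply_one_zero hzero
    have e : g' = ((⟨γ, hγmem⟩⁻¹ : Gamma0 N) : SL(2, ℤ)) * (g * (g⁻¹ * γ * g')) := by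
      rw [InvMemClass.coe_inv]; group
    rw [e, hγ]
    rcases hj with hj | hj
    · rw [hj, hTz]
    · rw [hj, mul_neg, hneg, hTz]
  obtain ⟨rep, hrep⟩ : ∃ rep : CuspOrbits (Gamma0 N : Subgroup (GL (Fin 2) ℝ)) → SL(2, ℤ), ∀ c, cuspOrbitOf N (rep c) = c :=
    ⟨fun c ↦ Classical.choose (cuspOrbitOf_surjective N c), fun c ↦ Classical.choose_spec (cuspOrbitOf_surjective N c)⟩
  refine ⟨fun c ↦ Sf (rep c), fun g ↦ ?_⟩
  have e1 : Sf (rep (cuspOrbitOf N g)) = Sf g := hcusp _ _ (hrep _)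
  have e2 : Sf (rep (cuspOrbitOf N (g * S))) = Sf (g * S) := hcusp _ _ (hrep _)
  show Mc g = Sf (rep (cuspOrbitOf N g)) - Sf (rep (cuspOrbitOf N (g * S)))
  rw [e1, e2]
  -- the chain `ch (gS) ++ [g]` of `g`
  have hL : ∀ {A : Type} [AddCommGroup A] (F : SL(2, ℤ) → A), (∀ g, F (g * T) = F g) → (∀ g, F (-g) = F g) →
      ((ch (g * S) ++ [g]).map fun h ↦ F h - F (h * S)).sum = F g - F 1 := by
    intro A _ F hT hn
    rw [List.map_append, List.sum_append, hch (g * S) F hT hn, List.map_singleton, List.sum_singleton]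
    abel
  have h := hW g _ hL
  rw [List.map_append, List.sum_append, List.map_singleton, List.sum_singleton] at h
  rw [← h]
  show Mc g = ((ch (g * S)).map Mc).sum + Mc g - Sf (g * S)
  show Mc g = Sf (g * S) + Mc g - Sf (g * S)
  abel

end Kernel

/-! ## §2. Surjectivity: every additive map on `Λ` comes from a Manin system -/

section Surjective

variable {R : Type} [AddCommGroup R] {N : ℕ} [NeZero N]

/-- **Every `φ ∈ Hom(Λ, R)` is the chain-sum map of a Manin system killing the elliptic cosets** (`R` without `3`-torsion): there is
`M : Gamma0Coset N → R` with (i)–(iv) of `…ManinSystemFactor` and `φ({∞, k∞}) = Σ_{g∈L} M(g⁻¹Γ₀(N))` for every chain `L` of every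
`k ∈ Γ₀(N)`. (`M` = the Manin system of the symbol function of the cusp-elliptic character `φ ∘ per`.) [cite: Manin1972, Thm. 1.9] -/
theorem exists_maninSystem_of_addMonoidHom_periodHomology (φ : periodHomology N →+ R)
    (h3 : ∀ r : R, r + r + r = 0 → r = 0) :
    ∃ M : Gamma0Coset N → R,
      (∀ q, M (S • q) = -M q) ∧ (∀ q, M q + M ((T * S) • q) + M ((T * S) • (T * S) • q) = 0) ∧
      (∀ q, S • q = q → M q = 0) ∧ (∀ q, (T * S) • q = q → M q = 0) ∧
      ∀ (k : Gamma0 N) (L : List SL(2, ℤ)),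
        (∀ {A : Type} [AddCommGroup A] (F : SL(2, ℤ) → A), (∀ g, F (g * T) = F g) → (∀ g, F (-g) = F g) →
          (L.map fun g ↦ F g - F (g * S)).sum = F (k : SL(2, ℤ)) - F 1) →
        φ ⟨periodFunctional N k, periodFunctional_mem_periodHomology N k⟩ =
          (L.map fun g ↦ M ((g⁻¹ : SL(2, ℤ)) : Gamma0Coset N)).sum := by
  obtain ⟨u, hu⟩ : ∃ u : Gamma0 N → R, ∀ γ, u γ = φ ⟨periodFunctional N γ, periodFunctional_mem_periodHomology N γ⟩ :=
    ⟨_, fun _ ↦ rfl⟩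
  obtain ⟨hadd, hstab, hell⟩ := cuspCharacter_of_addMonoidHom_periodHomology (N := N) φ
  have hadd' : ∀ γ δ : Gamma0 N, u (γ * δ) = u γ + u δ := fun γ δ ↦ by rw [hu, hu, hu]; exact hadd γ δ
  have hstab' : ∀ (γ : Gamma0 N) (k : SL(2, ℤ)), (k⁻¹ * (γ : SL(2, ℤ)) * k) 1 0 = 0 → u γ = 0 :=
    fun γ k h ↦ by rw [hu]; exact hstab γ k h
  have hell' : ∀ (γ : Gamma0 N) (k : SL(2, ℤ)), (γ : SL(2, ℤ)) * k = k * S → u γ = 0 :=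
    fun γ k h ↦ by rw [hu]; exact hell γ k h
  obtain ⟨Φ, hM, hcuspv⟩ := exists_maninFunction_of_cuspCharacter u hadd' hstab'
  -- the Manin-symbol system of `Φ` on `SL₂(ℤ)` and on the coset space (as in `…PeriodFactor`)
  set MS : SL(2, ℤ) → R := fun h ↦ (if (h 1 0) = 0 then 0 else Φ (((h 0 0 : ℚ)) / ((h 1 0 : ℚ)))) -
    (if ((h * S) 1 0) = 0 then 0 else Φ ((((h * S) 0 0 : ℚ)) / (((h * S) 1 0 : ℚ)))) with hMS
  have hinv : ∀ (δ : Gamma0 N) (h : SL(2, ℤ)), MS ((δ : SL(2, ℤ)) * h) = MS h := fun δ h ↦ by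
    simp only [hMS]; exact maninSymbol_gamma0_mul hM δ h
  have hnegMS : ∀ h, MS (-h) = MS h := fun h ↦ by simp only [hMS]; exact maninSymbol_neg Φ h
  have hSMS : ∀ h, MS (h * S) = -MS h := fun h ↦ by
    have := maninSymbol_two_term Φ h
    simp only [hMS]
    exact eq_neg_of_add_eq_zero_right this
  have hτm : (S * T⁻¹ : SL(2, ℤ)) = ⟨!![0, -1; 1, -1], by norm_num [Matrix.det_fin_two_of]⟩ := by
    apply Subtype.ext
    rw [coe_mul, coe_S, coe_T_inv]
    ext i j
    fin_cases i <;> fin_cases j <;> simp [Matrix.mul_apply, Fin.sum_univ_two]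
  have h3t : ∀ h, MS h + MS (h * (S * T⁻¹)) + MS (h * (S * T⁻¹) * (S * T⁻¹)) = 0 := fun h ↦ by
    have := maninSymbol_three_term Φ h
    simp only [hMS]
    rw [hτm]
    exact this
  have hσ : ∀ (δ : Gamma0 N) (h : SL(2, ℤ)), (δ : SL(2, ℤ)) * h = h * S → MS h = 0 := fun δ h hfix ↦ by
    simp only [hMS]
    rw [maninSymbol_eq_neg_maninCusp_of_sigmaFixed hM δ h hfix, hcuspv, hell' δ h hfix, neg_zero]
  have hτ0 : ∀ (δ : Gamma0 N) (h : SL(2, ℤ)), (δ : SL(2, ℤ)) * h = h * (S * T⁻¹) → MS h = 0 :=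
    fun δ h hfix ↦ apply_eq_zero_of_tau_fixed MS hinv h3t h3 δ h hfix
  set M : Gamma0Coset N → R := fun q ↦ MS (q.out)⁻¹ with hMdef
  refine ⟨M, fun q ↦ cosetSystem_S MS hinv hnegMS hSMS q, fun q ↦ cosetSystem_TS MS hinv hnegMS h3t q,
    fun q hq ↦ cosetSystem_S_fixed MS hinv hσ q hq, fun q hq ↦ cosetSystem_TS_fixed MS hinv hτ0 q hq, ?_⟩
  intro k L hL
  have e4 : (L.map fun g ↦ M ((g⁻¹ : SL(2, ℤ)) : Gamma0Coset N)).sum =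
      (if ((k : SL(2, ℤ)) 1 0) = 0 then 0 else Φ ((((k : SL(2, ℤ)) 0 0 : ℚ)) / (((k : SL(2, ℤ)) 1 0 : ℚ)))) := by
    rw [← maninChain_sum_maninSymbol Φ hL]
    congr 1
    refine List.map_congr_left fun g _ ↦ ?_
    show MS ((((g⁻¹ : SL(2, ℤ)) : Gamma0Coset N)).out)⁻¹ = _
    rw [apply_out_inv_mk MS hinv, inv_inv]
  rw [e4, hcuspv, hu]

end Surjective

end Summit.BirchSwinnertonDyer.BirchSwinnertonDyer.Theorems.ThetaLayerLambdaCongruenceAtTwo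

end
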